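import Summits.ResolutionOfSingularities.ResolutionOfSingularities.Theorems.FrobeniusLadderFRationalResolutionCompletedBaseChangeFibreStalks
import Literature.AlgebraicGeometry.Resolution.FiniteCoverFormalFibres
import HarnessLib

/-!
# Crux `FrobeniusLadder.FRationalResolution` (stmt-ResolutionOfSingularities-15317), line `redirect`,
# stub `stub_diagonalizableQuotientResolution` — A FINITENESS CRITERION FOR THE CHART FACT `hfinm`: regular away from finitely
# many elements whose common zero locus over `𝔳` is finite

The two-step consumers ask, on each chart ring `C = T[J/y]`, for `hfinm`: the primes `𝔫 ⊇ 𝔳C` with `C_𝔫` not regular are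
finitely many, and `hmodel`: the point blow-up of `C_𝔫` is regular at each of them. Both reduce to finitely many explicit
primes once elements `g₁, …, g_s ∈ C` are given with (i) every localization `C[1/g_k]` a regular ring and (ii) the zero locus
`V(𝔳C + (g₁, …, g_s))` finite (e.g. `𝔳C + (g) ⊇ 𝔪^N` for a maximal `𝔪`): a prime over `𝔳` missing some `g_k` has
`C_𝔫 = (C[1/g_k])_𝔫` regular (Literature `isRegularLocalRing_localization_of_isLocalization_of_disjoint`). For a toric chart
ring `κ[P']` take the `g_k` = the monomial generators: `κ[P'][1/g_k]` regular for all `k` says that the cone of `P'` has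
regular proper faces, and `V(𝔳C + (g)) = {vertex}`.

* `mem_of_not_isRegularLocalRing` — a non-regular prime contains every `g_k` with `C[1/g_k]` regular;
* ★★ `finite_nonRegular_over_of_away_regular` — `hfinm` from (i) and (ii);
* ★★ `pointBlowup_over_of_away_regular` — `hmodel` from (i) and `hmodel` at the primes containing `𝔳C + (g)` only;
* `zeroLocus_finite_of_pow_le`, `zeroLocus_finite_of_isMaximal` — (ii) from `𝔪^N ≤ 𝔳C + (g)` / from maximality;
* ★★★ `chartFacts_of_away_regular_of_pow_le` — both chart facts from (i), `𝔪^N ≤ 𝔳C + (g)`, and `hmodel` at `𝔪` alone.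

Honest label: ring-level plumbing toward ONE leaf stub (no stub, crux or summit closed). No definitions, no named facts, no sorry.
[cite: Matsumura1987, Thm. 19.3 (localization of regular rings); §32] [cite: StacksProject, Tag 00PD; Tag 0804]
-/

noncomputable section

-- single-problem summit: the doubled namespace component is forced
set_option linter.dupNamespace false

open AlgebraicGeometry IsLocalRing
open Literature.AlgebraicGeometry.Resolution

namespace Summit.ResolutionOfSingularities.ResolutionOfSingularities.Theorems.FRationalResolution.ChartFactsFiniteCriterion

variable {C : Type} [CommRing C]

/-- A prime at which `C` is not regular contains every `g` with `C[1/g]` a regular ring (`C_𝔫` is a localization of `C[1/g]`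
when `g ∉ 𝔫`). [cite: Matsumura1987, Thm. 19.3] -/
theorem mem_of_not_isRegularLocalRing (g : C) (hreg : IsRegularRing (Localization.Away g)) (𝔫 : PrimeSpectrum C)
    (h𝔫 : ¬ IsRegularLocalRing (Localization.AtPrime 𝔫.asIdeal)) : g ∈ 𝔫.asIdeal := by
  by_contra hg
  haveI := hreg
  exact h𝔫 (isRegularLocalRing_localization_of_isLocalization_of_disjoint (W := Localization.Away g)
    (Submonoid.powers g) 𝔫.asIdeal ((Ideal.disjoint_powers_iff_notMem_of_isPrime g).mpr hg))

/-- ★★ **`hfinm` FROM REGULARITY AWAY FROM FINITELY MANY ELEMENTS.** If every `C[1/g_k]` is a regular ring and the zero locus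
`V(𝔞 + (g₁,…,g_s))` is finite, then the primes `𝔫 ⊇ 𝔞` with `C_𝔫` not regular are finitely many.
[cite: Matsumura1987, Thm. 19.3] [cite: StacksProject, Tag 00PD] -/
theorem finite_nonRegular_over_of_away_regular (𝔞 : Ideal C) {ι : Type*} (g : ι → C)
    (hreg : ∀ k, IsRegularRing (Localization.Away (g k)))
    (hfin : (PrimeSpectrum.zeroLocus ((𝔞 ⊔ Ideal.span (Set.range g) : Ideal C) : Set C)).Finite) :
    {𝔫 : PrimeSpectrum C | 𝔞 ≤ 𝔫.asIdeal ∧ ¬ IsRegularLocalRing (Localization.AtPrime 𝔫.asIdeal)}.Finite := by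
  refine hfin.subset ?_
  rintro 𝔫 ⟨h𝔞, h𝔫⟩
  rw [PrimeSpectrum.mem_zeroLocus, SetLike.coe_subset_coe, sup_le_iff, Ideal.span_le]
  refine ⟨h𝔞, ?_⟩
  rintro _ ⟨k, rfl⟩
  exact mem_of_not_isRegularLocalRing (g k) (hreg k) 𝔫 h𝔫

/-- ★★ **`hmodel` NEED ONLY BE CHECKED AT THE PRIMES CONTAINING `𝔞 + (g₁,…,g_s)`** when every `C[1/g_k]` is a regular ring.
[cite: Matsumura1987, Thm. 19.3] -/
theorem pointBlowup_over_of_away_regular (𝔞 : Ideal C) {ι : Type*} (g : ι → C)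
    (hreg : ∀ k, IsRegularRing (Localization.Away (g k)))
    (hmodel₀ : ∀ 𝔫 : PrimeSpectrum C, 𝔞 ⊔ Ideal.span (Set.range g) ≤ 𝔫.asIdeal →
      ¬ IsRegularLocalRing (Localization.AtPrime 𝔫.asIdeal) →
      Scheme.IsRegular (affineBlowup (R := Localization.AtPrime 𝔫.asIdeal) (maximalIdeal (Localization.AtPrime 𝔫.asIdeal)))) :
    ∀ 𝔫 : PrimeSpectrum C, 𝔞 ≤ 𝔫.asIdeal → ¬ IsRegularLocalRing (Localization.AtPrime 𝔫.asIdeal) →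
      Scheme.IsRegular (affineBlowup (R := Localization.AtPrime 𝔫.asIdeal) (maximalIdeal (Localization.AtPrime 𝔫.asIdeal))) := by
  intro 𝔫 h𝔞 h𝔫
  refine hmodel₀ 𝔫 (sup_le h𝔞 ?_) h𝔫
  rw [Ideal.span_le]
  rintro _ ⟨k, rfl⟩
  exact mem_of_not_isRegularLocalRing (g k) (hreg k) 𝔫 h𝔫

/-- The zero locus of an ideal containing a power of a maximal ideal is at most the one point `𝔪`. [folklore] -/
theorem zeroLocus_finite_of_pow_le (𝔟 : Ideal C) (𝔪 : Ideal C) [h𝔪 : 𝔪.IsMaximal] {N : ℕ} (hN : 𝔪 ^ N ≤ 𝔟) :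
    (PrimeSpectrum.zeroLocus ((𝔟 : Ideal C) : Set C)).Finite := by
  refine (Set.finite_singleton (⟨𝔪, h𝔪.isPrime⟩ : PrimeSpectrum C)).subset ?_
  intro 𝔫 h𝔫
  rw [PrimeSpectrum.mem_zeroLocus, SetLike.coe_subset_coe] at h𝔫
  have hle : 𝔪 ≤ 𝔫.asIdeal := Ideal.IsPrime.le_of_pow_le (hN.trans h𝔫)
  exact PrimeSpectrum.ext (h𝔪.eq_of_le 𝔫.isPrime.ne_top hle).symm

/-- The zero locus of a maximal ideal is one point. [folklore] -/
theorem zeroLocus_finite_of_isMaximal (𝔟 : Ideal C) [h𝔟 : 𝔟.IsMaximal] :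
    (PrimeSpectrum.zeroLocus ((𝔟 : Ideal C) : Set C)).Finite :=
  zeroLocus_finite_of_pow_le 𝔟 𝔟 (N := 1) (by rw [pow_one])

/-- A prime containing `𝔟 ⊇ 𝔪^N` is `𝔪`. [folklore] -/
theorem eq_of_pow_le_of_le (𝔟 : Ideal C) (𝔪 : Ideal C) [h𝔪 : 𝔪.IsMaximal] {N : ℕ} (hN : 𝔪 ^ N ≤ 𝔟)
    (𝔫 : PrimeSpectrum C) (h𝔫 : 𝔟 ≤ 𝔫.asIdeal) : 𝔫.asIdeal = 𝔪 :=
  (h𝔪.eq_of_le 𝔫.isPrime.ne_top (Ideal.IsPrime.le_of_pow_le (hN.trans h𝔫))).symm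

/-- ★★★ **BOTH CHART FACTS FROM: regularity away from `g₁,…,g_s`, `𝔪^N ⊆ 𝔞 + (g)` for a maximal `𝔪`, and the point blow-up at
`𝔪` alone.** The form in which a toric chart ring is certified: `g_k` the monomial generators (faces regular), `𝔪` the vertex
(`N = 1`), and ONE point blow-up `Bl_𝔪(Spec C_𝔪)` (e.g. by `…LocalToricModelBlowupAtPrime`). If `C_𝔪` happens to be regular the
last hypothesis is vacuous. [cite: Matsumura1987, Thm. 19.3] [cite: StacksProject, Tag 00PD; Tag 0804] -/
theorem chartFacts_of_away_regular_of_pow_le (𝔞 : Ideal C) {ι : Type*} (g : ι → C)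
    (hreg : ∀ k, IsRegularRing (Localization.Away (g k)))
    (𝔪 : Ideal C) [h𝔪 : 𝔪.IsMaximal] {N : ℕ} (hN : 𝔪 ^ N ≤ 𝔞 ⊔ Ideal.span (Set.range g))
    (hmodel𝔪 : ¬ IsRegularLocalRing (Localization.AtPrime 𝔪) →
      Scheme.IsRegular (affineBlowup (R := Localization.AtPrime 𝔪) (maximalIdeal (Localization.AtPrime 𝔪)))) :
    {𝔫 : PrimeSpectrum C | 𝔞 ≤ 𝔫.asIdeal ∧ ¬ IsRegularLocalRing (Localization.AtPrime 𝔫.asIdeal)}.Finite ∧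
    ∀ 𝔫 : PrimeSpectrum C, 𝔞 ≤ 𝔫.asIdeal → ¬ IsRegularLocalRing (Localization.AtPrime 𝔫.asIdeal) →
      Scheme.IsRegular (affineBlowup (R := Localization.AtPrime 𝔫.asIdeal) (maximalIdeal (Localization.AtPrime 𝔫.asIdeal))) := by
  refine ⟨finite_nonRegular_over_of_away_regular 𝔞 g hreg (zeroLocus_finite_of_pow_le _ 𝔪 hN),
    pointBlowup_over_of_away_regular 𝔞 g hreg fun 𝔫 h𝔫 hnreg => ?_⟩
  obtain ⟨𝔫, h𝔫p⟩ := 𝔫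
  have h := eq_of_pow_le_of_le _ 𝔪 hN ⟨𝔫, h𝔫p⟩ h𝔫
  change 𝔫 = 𝔪 at h
  subst h
  exact hmodel𝔪 hnreg

end Summit.ResolutionOfSingularities.ResolutionOfSingularities.Theorems.FRationalResolution.ChartFactsFiniteCriterion

end
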